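import Summits.CriticalPhenomena.PercolationContinuityZ3.Theorems.Transplant.SkelHabChainT
import Summits.CriticalPhenomena.PercolationContinuityZ3.Theorems.Transplant.KNCells2CorridorEdge
import HarnessLib

/-!
# L6.0-Ω (packaging) — **`Skel.hreach_of_habChain`**: `hreach` from a HABITAT CHAIN `Skel.HabChainData` (`SkelHabChainT`) in the window graph
# `winGraphIn G Ω`, for any lag-1 anchored scheme `S : KSchA V A` — twin of stmt-g7's `Skel.hreach_of_winChain` (`SkelWinPackaging` §1, p233842)
# with `winGraph ↦ winGraphIn`, `Win ↦ WinIn`; the corridor residue (C) uses it with `Ω := Ucor` (p3-g4's ruling 20:22:53Z, SHEAR-SCOPE §2.6)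

builds on p205010 (kernel theorem, internal audit signed; external expert review pending) — nothing in this file uses p205010.
Status sentence (coordinator 2026-08-20T04:30Z): "θ(p_c) = 0 on ℤ^d, all d ≥ 2 — kernel-verified (Lean 4/Mathlib, standard axioms); internal
adversarial audit SIGNED 2026-08-20 04:29Z; external expert review pending."
Lane `prim-bschramm-*`, seat `prim-bschramm-p2` (gen 4); helper file (`--supports stmt-CriticalPhenomena-4575`).
* **`hreach_of_habChain`** — after a valid history: the chain property for `winGraphIn G P.Ω`, per step the kit clause + subbox + support facts +
  rim excess `≤ η ≤ δ/2`, the arrival cube `M^{α}_y ⊆ Φ.WinIn Ω₀ (C.M y)` for some `Ω₀ ⊆ Ω` and the last target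
  `Φ.WinIn Ω (C.M z ∩ H_{y,z}) ⊆ M^{a'}_z` give `1 - ε'' < P_{Wfull}(Reach h e α a' du)` (generic core `KSchA.hreach_of_chain_edge_sub` at
  `G' := winGraphIn G P.Ω`, which is region-agnostic).
[cite: KozmaNitzan2024, §4 Lemma 12 (pp. 23–25), p. 30 (Step IV)]
-/

noncomputable section

open MeasureTheory ProbabilityTheory
open scoped ENNReal Classical

namespace Summit.CriticalPhenomena.PercolationContinuityZ3.Theorems

namespace Transplant

namespace Skel

open Literature.Probability.Percolation Literature.Probability.LatticeModels SimpleGraph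
open Literature.Probability.Percolation.KozmaNitzan
open KNLevels ChainPlanar

variable {V : Type} {G : SimpleGraph V} [G.LocallyFinite] (Φ : PlanarSkeletonConc G)

/-! ## §2 `hreach` from a habitat chain -/

open KNCells GadgetSystem ProbeHistory HSiteScheme Contour

variable [DecidableEq V] [Countable V] {A : Type*} {S : KSchA V A} {FD : FaceData V A}
variable {h : ProbeHistory V} {e : Site 2 × MDir} {a' : A} {du : MDir}

/-- **`hreach` FROM A HABITAT CHAIN** (generic design (D), corridor residue (C) over `winGraphIn G Ω`). [cite: KozmaNitzan2024, §4 Lemma 12 (pp. 23–25), p. 30 (Step IV)] -/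
theorem hreach_of_habChain (P : HabChainData V) (hV : S.Valid₂ G h e) {Δ' : ℕ} {δ ε'' η : ℝ}
    (hδc : S.δc ≤ δ)
    (hchain : ∀ (Wg : Sym2 V → unitInterval) (s : Fin (ChainPlanar.Sched.nLast + 1) → KNLevels.TStep (winGraphIn G P.Ω))
      (T' : Fin (ChainPlanar.Sched.nLast + 1) → Finset V) (η : ℝ),
      (∀ i, (s i).L.o = (s 0).L.o) →
      (∀ i : Fin ChainPlanar.Sched.nLast, T' (Fin.castSucc i) ⊆ (s i.succ).L.X 0) →
      (∀ i, T' i ⊆ (s i).T) →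
      (∀ i, (s i).KitsAt Wg S.p Δ' δ) →
      η ≤ δ / 2 →
      (∀ i, (prodBernoulli Wg).real (⋃ t ∈ (s i).T \ T' i, openConn (s 0).L.o t) ≤ η) →
      1 - δ < (prodBernoulli Wg).real (s 0).L.reachB →
        1 - ε'' < (prodBernoulli Wg).real (⋃ t ∈ T' (Fin.last ChainPlanar.Sched.nLast), openConn (s 0).L.o t))
    (hroot : P.root = S.Γ.root)
    (hr : P.C.r = 4 * P.t) (hR : 100 * P.R' ≤ P.t) (hRl : P.Rlev + 1 ≤ P.R') (hRim : ∀ i, P.Rim i ⊆ P.stepD Φ i)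
    (hTne : ∀ i ≤ ChainPlanar.Sched.nLast, (P.tgtT Φ i).Nonempty)
    (hj : P.j₁ ≤ P.Rlev) (hcount : 1 / (1 - (S.p : ℝ)) ^ (Δ' * P.N) ≤ δ * ((Finset.Icc P.j₀ P.j₁).card : ℝ))
    (hsub : ∀ i ≤ ChainPlanar.Sched.nLast,
      KNLevels.IsSubbox (winGraphIn G P.Ω) (S.Wcor G FD h e (S.aOf₁ G h e) a' du) S.p (P.stepD Φ i))
    (hfin : KNLevels.FinSupp (S.Wcor G FD h e (S.aOf₁ G h e) a' du) P.Sfin)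
    (hDS : ∀ i ≤ ChainPlanar.Sched.nLast, P.stepD Φ i ⊆ P.Sfin) (ho : ∀ i ≤ ChainPlanar.Sched.nLast, P.root ∉ P.stepD Φ i)
    (hoS : P.root ∈ P.Sfin)
    (hkits : ∀ i ≤ ChainPlanar.Sched.nLast, ∀ j ∈ Finset.Icc P.j₀ P.j₁,
      ∃ (σ : KNLevels.SData V) (Sz : Finset V),
      KNLevels.SHyp (winLDataIn Φ P.Ω (P.lo i) (P.hi i) P.root P.Sfin) j σ ∧ σ.N ≤ P.N ∧
      (1 - (S.p : ℝ) ^ σ.sB) ^ σ.k ≤ δ ∧ Sz ⊆ (winLDataIn Φ P.Ω (P.lo i) (P.hi i) P.root P.Sfin).X j ∧ Sz ⊆ P.stepD Φ i ∧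
      (∀ x ∈ σ.K, ∀ e' ∈ σ.seed x, e' ∉ wireSet (↑Sz : Set V)) ∧ (∀ x ∈ σ.K, σ.face x ⊆ Sz) ∧
      (∀ x ∈ σ.K, 1 - 3 * δ ≤ (prodBernoulli (S.Wcor G FD h e (S.aOf₁ G h e) a' du)).real {ω | ∃ u ∈ σ.face x,
        1 - δ < (prodBernoulli (pinW (S.Wcor G FD h e (S.aOf₁ G h e) a' du) (wireSet (↑Sz : Set V)) ω)).real
          (⋃ t ∈ P.tgtE Φ i, openConnIn (↑(P.stepD Φ i) : Set V) u t)}))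
    (hη : η ≤ δ / 2)
    (hexc : ∀ i ≤ ChainPlanar.Sched.nLast, (prodBernoulli (S.Wcor G FD h e (S.aOf₁ G h e) a' du)).real
      (⋃ t ∈ P.Rim i, openConn S.Γ.root t) ≤ η)
    {Ω₀ : Finset V} (hΩ₀ : Ω₀ ⊆ P.Ω) (hM0 : S.Γ.M (S.aOf₁ G h e) (tgt e) ⊆ Φ.WinIn Ω₀ (P.C.M P.x))
    (hMn : Φ.WinIn P.Ω (P.C.M (P.x + stepVec P.du) ∩ P.C.Hfull P.x P.du) ⊆ S.Γ.M a' (tgt e + stepVec du)) :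
    1 - ε'' < (prodBernoulli (S.Wfull G h e (S.aOf₁ G h e) a' du)).real (S.Reach G FD h e (S.aOf₁ G h e) a' du) := by
  -- the chain as `Fin (nLast + 1)`-indexed target steps
  let s : Fin (ChainPlanar.Sched.nLast + 1) → KNLevels.TStep (winGraphIn G P.Ω) := fun i => P.stepH Φ i
  let T' : Fin (ChainPlanar.Sched.nLast + 1) → Finset V := fun i => P.tgtT Φ i
  have hle : ∀ i : Fin (ChainPlanar.Sched.nLast + 1), (i : ℕ) ≤ ChainPlanar.Sched.nLast := fun i => Nat.lt_succ_iff.1 i.2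
  refine KSchA.hreach_of_chain_edge_sub (winGraphIn G P.Ω) hV hδc hchain s T' (fun i => ?_) (fun i => ?_) (fun i => ?_)
    (fun i => ?_) hη (fun i => ?_) ?_ ?_
  · show (P.stepH Φ i).L.o = S.Γ.root
    rw [HabChainData.stepH_o, hroot]
  · show P.tgtT Φ (Fin.castSucc i) ⊆ (P.stepH Φ i.succ).L.X 0
    have : ((i.succ : Fin (ChainPlanar.Sched.nLast + 1)) : ℕ) = (Fin.castSucc i : ℕ) + 1 := by simp
    rw [show P.stepH Φ (i.succ : ℕ) = P.stepH Φ ((Fin.castSucc i : ℕ) + 1) by rw [this]]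
    exact P.tgtT_subset_X_zero_succ Φ _
  · exact P.tgtT_subset_tgtE Φ i
  · exact HabChainData.kitsAt_stepH Φ hR hRl hRim (hle i) (hTne i (hle i)) (hsub i (hle i)) hfin (hDS i (hle i)) (ho i (hle i)) hoS hj
      hcount (hkits i (hle i))
  · refine le_trans (measureReal_mono ?_ (measure_ne_top _ _)) (hexc i (hle i))
    intro ω hω
    simp only [Set.mem_iUnion, exists_prop] at hω ⊢
    obtain ⟨t, ht, hωt⟩ := hω
    exact ⟨t, P.tgtE_sdiff_subset Φ i ht, hωt⟩
  · -- the arrival cube lies in the first core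
    show S.Γ.M (S.aOf₁ G h e) (tgt e) ⊆ (P.stepH Φ ((0 : Fin (ChainPlanar.Sched.nLast + 1)) : ℕ)).L.X 0
    exact hM0.trans (HabChainData.cube_subset_X_zero Φ hr hR hΩ₀)
  · -- the last true target lies in `M_{x+du}`
    show P.tgtT Φ ((Fin.last ChainPlanar.Sched.nLast : Fin _) : ℕ) ⊆ S.Γ.M a' (tgt e + stepVec du)
    rw [Fin.val_last]
    exact (HabChainData.tgtT_last_subset Φ hr hR).trans hMn

end Skel

end Transplant

end Summit.CriticalPhenomena.PercolationContinuityZ3.Theorems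

end
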